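import Summits.QuantumFields.BalabanUV.Beta.SecondOrderTransport
import Literature.MathematicalPhysics.QuantumFieldTheory.Balaban1983to89.Beta.BalabanStepW2
import Literature.MathematicalPhysics.QuantumFieldTheory.Balaban1983to89.Beta.AxialDressing
import Literature.MathematicalPhysics.QuantumFieldTheory.Balaban1983to89.Beta.KernelReflection

/-!
# `BalabanUV.Gaps.D1PinnedFirstOrderQuadratic` — cell pub-balaban-gaps, row (D1), seat g1-p1: THE FIRST-ORDER PAIR `(S, M)` ENTERS an2's SECOND-ORDER OBJECTS THROUGH
# HOMOGENEOUS QUADRATIC MAPS — under `(S, M) ↦ (t•S, t•M)` the first-order part of the carrier `W2OfK ∕ W2SymOfK` and the `W`-free part of the third-order read-out `K3OfK`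
# pick up EXACTLY the factor `t²` (the bi-vertex, mixed and sandwich parts are untouched), and the bubble half of `hessKer` the factor `t²`: the second brick of the degree count
# «`φ` is a quartic» (census rows 71 (d) ∕ 72b)

HONEST FRAMING (cell rule, page 1 of everything): [folklore] unfolding of an2's ∕ the β sub-cell's DEFINITIONS (`SecondOrderResponse.dM ∕ K2OfK ∕ W2OfK ∕ W2SymOfK`, `BalabanStepW2.K3OfK`,
`AxialDressing.axVertexOfK`, `ExpKernelCalculus.hessKer`) under scaling, with the UNCONDITIONAL homogeneity letters of `SecondOrderTransport` (`vertexOfK_smul_family ∕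
vertexOfM_smul_family ∕ dM_smul_kernel`) and `KernelReflection` (`comp_smul_left ∕ comp_smul_right ∕ bubble_smul_left ∕ bubble_smul_right`) BY NAME; NOTHING of Bałaban's
asserted; no value computed; (P6) untouched; (D1) NOT discharged; 0∕4 row-D1 binders; NOT `BetaPertH`, NOT continuum, NOT Clay.  HONEST DEPENDENCY (b2b cell, verbatim):
«continuum YM on T⁴ ⇐ BetaPertH ∧ nine spine estimates (0/9 proved); BetaPertH ⇐ (D1) ∧ (D4) ∧ CAP+tail; G-an2-4 gates asym, D1 and NE2/3/4.»

WHY (row (D1); census row 72b — the successor's typed plan for «`β⁰_j` and `φ` are polynomials of degree ≤ 4 in `(cE,cVH,cΛ)`»).  Its step (1) asks that the first-order pair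
`(S, M)` of an2's jet datum enter the second-order objects through QUADRATIC maps.  The HOMOGENEITY half of that statement is unconditional and is typed here: §1 the operator
derivative `dM` and the derivative of the inverse `K2OfK` are homogeneous of degree 1 in the pair, hence the first-order part `dM (K2OfK K N S M b′) N S M b` of the carrier is
homogeneous of degree 2 (`dM_K2OfK_scale`); §2 the carrier and its symmetrisation therefore satisfy **`W2OfK_firstOrder_scale`** ∕ **`W2SymOfK_firstOrder_scale`**
(`W(t•S, t•M) = W(S, M) + (t² − 1)•D(S, M)`); §3 the third-order read-out satisfies **`K3OfK_firstOrder_scale`** (`K3OfK K N (t•S) (t•M) W b = t²•K3OfK K N S M W b + (t² − 1)•(K∘W b∘K)`: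
its `W`-free part is homogeneous of degree 2, its sandwich untouched); §4 the axial vertex family is homogeneous of degree 1 and the bubble half of `hessKer` picks up `t²`
(**`hessKer_vertex_scale`**).  With `Gaps/D1PinnedColourScaling` (the pair itself is `(t²A + tB, tM)` under `c⃗ ↦ t·c⃗`) these are the unconditional ingredients of the count;
the ADDITIVITY half (bilinearity with `LocStencil` side conditions) and the tower induction remain for the successor (row 72b).
CONTENT (all [folklore]; no `def`, no `def … : Prop`, nothing cited as a hypothesis, 0 sorry): §1 `dM_scale`, `K2OfK_scale`, `dM_K2OfK_scale`; §2 `W2OfK_firstOrder_scale`,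
`W2SymOfK_firstOrder_scale`; §3 `K3OfK_firstOrder_scale`; §4 `axVertexOfK_scale`, `hessKer_vertex_scale`.

Provenance: cell pub-balaban-gaps, seat g1-p1 GEN 10 (prover-pub-balaban-gaps-g1-p1-g10-0), 2026-08-23; imports an2's ∕ gan24's `Beta.SecondOrderTransport` and the Literature
`Beta.BalabanStepW2 ∕ AxialDressing ∕ KernelReflection` ONLY (built); no existing file touched.
-/

noncomputable section

open Finset
open scoped BigOperators
open Literature.MathematicalPhysics.QuantumFieldTheory Balaban1983to89 Balaban1983to89.Beta
open ExpKernelCalculus (MKer comp hessKer tadpole bubble)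
open OneStepResolventKernel (Fib)
open OneStepKernelFamily (vertexOfK)
open SecondOrderResponse (dM K2OfK W2OfK W2OfK_apply W2SymOfK vertexOfM)
open BalabanStepW2 (K3OfK)
open AxialDressing (axVertexOfK)
open KernelReflection (bubble_smul_left bubble_smul_right)
open Summit.QuantumFields.BalabanUV.Beta.SecondOrderTransport (vertexOfK_smul_family vertexOfM_smul_family dM_smul_kernel)

namespace Summit.QuantumFields.BalabanUV.Gaps.D1PinnedFirstOrderQuadratic

variable {d : ℕ} {N : ℕ} [NeZero N]

/-! ## §1 `dM` and `K2OfK` are homogeneous of degree 1 in the first-order pair; the carrier's first-order part is homogeneous of degree 2 -/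

/-- [folklore] **THE OPERATOR DERIVATIVE IS HOMOGENEOUS OF DEGREE 1 IN THE FIRST-ORDER PAIR**: `dM K N (t•S) (t•M) b = t • dM K N S M b`
(`SecondOrderTransport.vertexOfK_smul_family ∕ vertexOfM_smul_family`). -/
theorem dM_scale (K : MKer (d + 1) (Fib d)) (t : ℝ) (S M : Fin (d + 1) → (Fin (d + 1) → ℤ) → MKer (d + 1) (Fib d))
    (μ : Fin (d + 1)) (y : Fin (d + 1) → ℤ) :
    dM K N (t • S) (t • M) μ y = t • dM K N S M μ y := by
  unfold SecondOrderResponse.dM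
  rw [show (t • S) = fun κ u => t • S κ u from rfl, show (t • M) = fun ρ w => t • M ρ w from rfl,
    vertexOfK_smul_family K t S μ y, vertexOfM_smul_family (N := N) K t M μ y, smul_add]

/-- [folklore] **THE DERIVATIVE OF THE INVERSE IS HOMOGENEOUS OF DEGREE 1 IN THE FIRST-ORDER PAIR**: `K2OfK K N (t•S) (t•M) b′ = t • K2OfK K N S M b′`. -/
theorem K2OfK_scale (K : MKer (d + 1) (Fib d)) (t : ℝ) (S M : Fin (d + 1) → (Fin (d + 1) → ℤ) → MKer (d + 1) (Fib d))
    (ν : Fin (d + 1)) (y' : Fin (d + 1) → ℤ) :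
    K2OfK K N (t • S) (t • M) ν y' = t • K2OfK K N S M ν y' := by
  funext x z a b
  simp only [SecondOrderResponse.K2OfK, Pi.smul_apply, smul_eq_mul]
  rw [dM_scale, KernelReflection.comp_smul_right, KernelReflection.comp_smul_left]
  simp only [Pi.smul_apply, smul_eq_mul]
  ring

/-- [folklore] **THE CARRIER's FIRST-ORDER PART IS HOMOGENEOUS OF DEGREE 2**: `dM (K2OfK K N (t•S) (t•M) b′) N (t•S) (t•M) b = t² • dM (K2OfK K N S M b′) N S M b`
(`K2OfK_scale`, `dM_smul_kernel`, `dM_scale`). -/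
theorem dM_K2OfK_scale (K : MKer (d + 1) (Fib d)) (t : ℝ) (S M : Fin (d + 1) → (Fin (d + 1) → ℤ) → MKer (d + 1) (Fib d))
    (μ : Fin (d + 1)) (y : Fin (d + 1) → ℤ) (ν : Fin (d + 1)) (y' : Fin (d + 1) → ℤ) :
    dM (K2OfK K N (t • S) (t • M) ν y') N (t • S) (t • M) μ y = t ^ 2 • dM (K2OfK K N S M ν y') N S M μ y := by
  rw [K2OfK_scale, dM_smul_kernel, dM_scale, smul_smul, sq]

/-! ## §2 The carrier and its symmetrisation: `W(t•S, t•M) = W(S, M) + (t² − 1)•D(S, M)` -/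

/-- [folklore] **THE SECOND-ORDER CARRIER UNDER SCALING OF THE FIRST-ORDER PAIR**:
`W2OfK K N (t•S) (t•M) S₂ M₂ b b′ = W2OfK K N S M S₂ M₂ b b′ + (t² − 1) • dM (K2OfK K N S M b′) N S M b` — the bi-vertex and the two mixed vertices do not see `(S, M)`, the
first-order part is homogeneous of degree 2 (`W2OfK_apply`, `dM_K2OfK_scale`). -/
theorem W2OfK_firstOrder_scale (K : MKer (d + 1) (Fib d)) (t : ℝ) (S M : Fin (d + 1) → (Fin (d + 1) → ℤ) → MKer (d + 1) (Fib d))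
    (S₂ M₂ : Fin (d + 1) → (Fin (d + 1) → ℤ) → Fin (d + 1) → (Fin (d + 1) → ℤ) → MKer (d + 1) (Fib d))
    (μ : Fin (d + 1)) (y : Fin (d + 1) → ℤ) (ν : Fin (d + 1)) (y' : Fin (d + 1) → ℤ) :
    W2OfK K N (t • S) (t • M) S₂ M₂ μ y ν y' =
      W2OfK K N S M S₂ M₂ μ y ν y' + (t ^ 2 - 1) • dM (K2OfK K N S M ν y') N S M μ y := by
  rw [W2OfK_apply, W2OfK_apply, dM_K2OfK_scale, sub_smul, one_smul]
  abel

/-- [folklore] **THE SYMMETRISED CARRIER UNDER SCALING OF THE FIRST-ORDER PAIR**: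
`W2SymOfK K N (t•S) (t•M) S₂ M₂ b b′ = W2SymOfK K N S M S₂ M₂ b b′ + (t² − 1) • ½•(dM (K2OfK K N S M b′) N S M b + dM (K2OfK K N S M b) N S M b′)`. -/
theorem W2SymOfK_firstOrder_scale (K : MKer (d + 1) (Fib d)) (t : ℝ) (S M : Fin (d + 1) → (Fin (d + 1) → ℤ) → MKer (d + 1) (Fib d))
    (S₂ M₂ : Fin (d + 1) → (Fin (d + 1) → ℤ) → Fin (d + 1) → (Fin (d + 1) → ℤ) → MKer (d + 1) (Fib d))
    (μ : Fin (d + 1)) (y : Fin (d + 1) → ℤ) (ν : Fin (d + 1)) (y' : Fin (d + 1) → ℤ) :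
    W2SymOfK K N (t • S) (t • M) S₂ M₂ μ y ν y' =
      W2SymOfK K N S M S₂ M₂ μ y ν y' +
        (t ^ 2 - 1) • ((1 / 2 : ℝ) • (dM (K2OfK K N S M ν y') N S M μ y + dM (K2OfK K N S M μ y) N S M ν y')) := by
  simp only [SecondOrderResponse.W2SymOfK]
  rw [W2OfK_firstOrder_scale, W2OfK_firstOrder_scale]
  funext x z a b
  simp only [Pi.add_apply, Pi.smul_apply, smul_eq_mul]
  ring

/-! ## §3 The third-order read-out: `W`-free part homogeneous of degree 2, sandwich untouched -/

/-- [folklore] **THE THIRD-ORDER READ-OUT UNDER SCALING OF THE FIRST-ORDER PAIR**: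
`K3OfK K N (t•S) (t•M) W b b′ = t² • K3OfK K N S M W b b′ + (t² − 1) • (K ∘ W b b′ ∘ K)` — the two `∂𝕄·∂(𝕄⁻¹)` products are homogeneous of degree 2 (`dM_scale`, `K2OfK_scale`,
`comp_smul_left ∕ _right`), the sandwich `−K∘W∘K` does not see the pair. -/
theorem K3OfK_firstOrder_scale (K : MKer (d + 1) (Fib d)) (t : ℝ) (S M : Fin (d + 1) → (Fin (d + 1) → ℤ) → MKer (d + 1) (Fib d))
    (W : Fin (d + 1) → (Fin (d + 1) → ℤ) → Fin (d + 1) → (Fin (d + 1) → ℤ) → MKer (d + 1) (Fib d))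
    (μ : Fin (d + 1)) (y : Fin (d + 1) → ℤ) (ν : Fin (d + 1)) (y' : Fin (d + 1) → ℤ) :
    K3OfK K N (t • S) (t • M) W μ y ν y' =
      t ^ 2 • K3OfK K N S M W μ y ν y' + (t ^ 2 - 1) • comp (comp K (W μ y ν y')) K := by
  funext x z a b
  simp only [BalabanStepW2.K3OfK, Pi.add_apply, Pi.smul_apply, smul_eq_mul, dM_scale, K2OfK_scale, KernelReflection.comp_smul_right,
    KernelReflection.comp_smul_left]
  ring

/-! ## §4 The axial vertex family is homogeneous of degree 1; the bubble half of `hessKer` picks up `t²` -/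

/-- [folklore] The axially dressed vertex family is homogeneous of degree 1 in the stencil family (a weighted superposition). -/
theorem axVertexOfK_scale (K : MKer (d + 1) (Fib d)) (L : ℕ) (t : ℝ) (S : Fin (d + 1) → (Fin (d + 1) → ℤ) → MKer (d + 1) (Fib d))
    (μ : Fin (d + 1)) (y : Fin (d + 1) → ℤ) :
    axVertexOfK K L (t • S) μ y = t • axVertexOfK K L S μ y := by
  funext x z a b
  simp only [AxialDressing.axVertexOfK, OneStepResolventKernel.wsum, Pi.smul_apply, smul_eq_mul]
  rw [Finset.mul_sum]
  refine Finset.sum_congr rfl fun κ' _ => ?_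
  rw [← tsum_mul_left]
  exact tsum_congr fun u => by ring

/-- [folklore] **`hessKer` UNDER SCALING OF THE VERTEX FAMILY**: `hessKer A (t•V) W μ ν z = hessKer A V W μ ν z − (t² − 1)·½·bubble A (V μ 0) (V ν z)` — the tadpole does not see `V`,
the bubble is bilinear (`KernelReflection.bubble_smul_left ∕ _right`). -/
theorem hessKer_vertex_scale {D : ℕ} {F : Type*} [Fintype F] (A : MKer D F) (t : ℝ) (V : Fin D → (Fin D → ℤ) → MKer D F)
    (W : Fin D → (Fin D → ℤ) → Fin D → (Fin D → ℤ) → MKer D F) (μ ν : Fin D) (z : Fin D → ℤ) :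
    hessKer A (t • V) W μ ν z = hessKer A V W μ ν z - (t ^ 2 - 1) * ((1 / 2) * bubble A (V μ 0) (V ν z)) := by
  simp only [ExpKernelCalculus.hessKer, Pi.smul_apply]
  rw [bubble_smul_left, bubble_smul_right]
  ring

end Summit.QuantumFields.BalabanUV.Gaps.D1PinnedFirstOrderQuadratic

end
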